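import Summits.ABC.ABC.Theses.IneffectiveSubspace

/-!
# `TowerFourGivesDepthCounted` (stmt-ABC-14940, route ABC/IneffectiveSubspace) — the dictionary

This file proves the support item `TowerFourGivesDepthCounted` of the route file
`Summits/ABC/ABC/Theses/IneffectiveSubspace.lean`:

`UniformSadicTowerFour → DepthCountedABC`.

**Proof** (the planner's dictionary, Vojta 2000 §3.1 lifts at level `4`).  Fix `K, ε` and take
`C = C(K, ε)` from `UniformSadicTowerFour`.  Given an abc triple `(a, b, c)` whose set
`D = {p : v_p(abc) ≥ 5}` of *deep* primes has `|D| ≤ K`, lift each of `a, b, c` to level `4`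
optimally: for `m = ∏ p ^ v_p` put, at the slot of exponent `k ∈ {1, 2, 3}` (index `k - 1`), the
squarefree number `∏_{v_p ≡ k (mod 4)} p`, and at the slot of exponent `4` (index `3`) the number
`∏ p ^ ⌊v_p / 4⌋`.  Then `∏ xᵢ^(i+1) = m`, all `xᵢ ≥ 1`, and `v_p(∏ xᵢ) = ⌈v_p(m) / 4⌉`
(`TowerFourGivesDepthCounted.exists_lift`).  For the point `(x, y, z)` of the level-4 tower the
hypotheses of `UniformSadicTowerFour` are those of the triple, and with `S := D` one has
`v_p(∏ xᵢyᵢzᵢ) = ⌈v_p(abc)/4⌉`, which is `1` off `D`; hence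
`(∏_{p ∈ S} p) · {∏ xᵢyᵢzᵢ}^S = ∏_{p ∣ abc} p = rad(abc)` on the nose, and the tower inequality
reads `c < C · rad(abc)^(1+ε)`.

Sources: P. Vojta, *On the ABC conjecture and diophantine approximation by rational points*,
Amer. J. Math. 122 (2000), §3.1 [Vojta2000ABC] (the lift); the item text of stmt-ABC-14940.
Uses only Mathlib (`Nat.factorization`, `Nat.primeFactors`, `Nat.radical_eq_prod_primeFactors`).
Compare `Theorems/IneffectiveSubspaceCanonicalTowerLift.lean` (the same lift at level `n`, with
only the size bound recorded).
-/

-- `Summit.<Summit>.<Problem>` is the mandated summit-side namespace (CONVENTIONS §2); for the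
-- single-conjunct summit `ABC` the two coincide, so the duplicate `ABC.ABC` is deliberate.
set_option linter.dupNamespace false

namespace Summit.ABC.ABC.Theorems

open scoped BigOperators
open Finset

/-- Level-4 bookkeeping, weighted form: with the slot exponents
`e_k(v) = [k = 3]·⌊v/4⌋ + [k ≠ 3]·[v ≡ k + 1 (mod 4)]` one has `∑_{k<4} (k+1)·e_k(v) = v`. [folklore] -/
theorem TowerFourGivesDepthCounted.sum_range_four_weighted (v : ℕ) :
    ∑ k ∈ Finset.range 4,
        (if k = 3 then v / 4 else if v % 4 = k + 1 then 1 else 0) * (k + 1) = v := by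
  simp only [Finset.sum_range_succ, Finset.sum_range_zero]
  norm_num
  split_ifs <;> omega

/-- Level-4 bookkeeping, plain form: `∑_{k<4} e_k(v) = ⌈v/4⌉ = (v + 3) / 4`. [folklore] -/
theorem TowerFourGivesDepthCounted.sum_range_four (v : ℕ) :
    ∑ k ∈ Finset.range 4,
        (if k = 3 then v / 4 else if v % 4 = k + 1 then 1 else 0) = (v + 3) / 4 := by
  simp only [Finset.sum_range_succ, Finset.sum_range_zero]
  norm_num
  split_ifs <;> omega

/-- **Optimal level-4 lift** (Vojta 2000 §3.1 at `n = 4`): for `m ≠ 0` there is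
`x : Fin 4 → ℕ`, all `xᵢ ≥ 1`, with `∏ xᵢ^(i+1) = m` and `v_p(∏ xᵢ) = ⌈v_p(m)/4⌉` for every `p`.
Witness: `xᵢ = ∏_{p ∣ m} p^(e_i(v_p(m)))` with the slot exponents of
`TowerFourGivesDepthCounted.sum_range_four_weighted`. [cite: Vojta2000ABC, §3.1] -/
theorem TowerFourGivesDepthCounted.exists_lift {m : ℕ} (hm : m ≠ 0) :
    ∃ x : Fin 4 → ℕ, (∀ i, 0 < x i) ∧ (∏ i, x i ^ (i.val + 1)) = m ∧
      ∀ p, (∏ i, x i).factorization p = (m.factorization p + 3) / 4 := by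
  -- exponent of a prime with valuation `v` in slot `k`
  let ex : ℕ → ℕ → ℕ := fun v k => if k = 3 then v / 4 else if v % 4 = k + 1 then 1 else 0
  have hsumw : ∀ v, ∑ i : Fin 4, ex v i.val * (i.val + 1) = v := fun v =>
    (Fin.sum_univ_eq_sum_range (fun k => ex v k * (k + 1)) 4).trans
      (TowerFourGivesDepthCounted.sum_range_four_weighted v)
  have hsum : ∀ v, ∑ i : Fin 4, ex v i.val = (v + 3) / 4 := fun v =>
    (Fin.sum_univ_eq_sum_range (fun k => ex v k) 4).trans
      (TowerFourGivesDepthCounted.sum_range_four v)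
  have hprime : ∀ p ∈ m.primeFactors, p.Prime := fun p hp => Nat.prime_of_mem_primeFactors hp
  have hfac : ∏ p ∈ m.primeFactors, p ^ m.factorization p = m := by
    conv_rhs => rw [← Nat.prod_factorization_pow_eq_self hm,
      Nat.prod_factorization_eq_prod_primeFactors]
  refine ⟨fun i => ∏ p ∈ m.primeFactors, p ^ ex (m.factorization p) i.val, fun i => ?_, ?_, ?_⟩
  · -- positivity
    exact Finset.prod_pos fun p hp => pow_pos (hprime p hp).pos _
  · -- `∏ xᵢ^(i+1) = m`: regroup prime by prime and use the weighted bookkeeping identity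
    calc (∏ i : Fin 4, (∏ p ∈ m.primeFactors, p ^ ex (m.factorization p) i.val) ^ (i.val + 1))
        = ∏ i : Fin 4, ∏ p ∈ m.primeFactors,
            p ^ (ex (m.factorization p) i.val * (i.val + 1)) := by
          refine Finset.prod_congr rfl fun i _ => ?_
          rw [← Finset.prod_pow]
          refine Finset.prod_congr rfl fun p _ => ?_
          rw [← pow_mul]
      _ = ∏ p ∈ m.primeFactors, ∏ i : Fin 4,
            p ^ (ex (m.factorization p) i.val * (i.val + 1)) := Finset.prod_comm
      _ = ∏ p ∈ m.primeFactors, p ^ m.factorization p := by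
          refine Finset.prod_congr rfl fun p _ => ?_
          rw [Finset.prod_pow_eq_pow_sum, hsumw]
      _ = m := hfac
  · -- `v_p(∏ xᵢ) = ⌈v_p(m)/4⌉`: `∏ xᵢ = ∏_{p ∣ m} p^⌈v_p/4⌉` is a product of prime powers
    intro p
    have hprod : (∏ i : Fin 4, ∏ p ∈ m.primeFactors, p ^ ex (m.factorization p) i.val) =
        ∏ p ∈ m.primeFactors, p ^ ((m.factorization p + 3) / 4) := by
      rw [Finset.prod_comm]
      refine Finset.prod_congr rfl fun p _ => ?_
      rw [Finset.prod_pow_eq_pow_sum, hsum]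
    have hF : (Finsupp.mapRange (fun e => (e + 3) / 4) (by norm_num) m.factorization).prod
        (· ^ ·) = ∏ p ∈ m.primeFactors, p ^ ((m.factorization p + 3) / 4) := by
      rw [Finsupp.prod_mapRange_index (h := (· ^ ·)) (fun _ => pow_zero _), Finsupp.prod,
        Nat.support_factorization]
    rw [hprod, ← hF, Nat.prod_pow_factorization_eq_self, Finsupp.mapRange_apply]
    exact fun q hq => Nat.prime_of_mem_primeFactors (Finsupp.support_mapRange hq)

/-- Coprime numbers have disjointly supported factorizations: for every `p`, one of
`v_p(m)`, `v_p(n)` vanishes. [folklore] -/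
theorem TowerFourGivesDepthCounted.factorization_eq_zero_or {m n : ℕ} (h : Nat.Coprime m n)
    (p : ℕ) : m.factorization p = 0 ∨ n.factorization p = 0 := by
  by_cases hpm : p ∣ m
  · by_cases hpn : p ∣ n
    · have hp1 : p = 1 := Nat.eq_one_of_dvd_coprimes h hpm hpn
      subst hp1
      exact Or.inl (Nat.factorization_one_right m)
    · exact Or.inr (Nat.factorization_eq_zero_of_not_dvd hpn)
  · exact Or.inl (Nat.factorization_eq_zero_of_not_dvd hpm)

/-- **The dictionary** (support item `TowerFourGivesDepthCounted`, stmt-ABC-14940):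
`UniformSadicTowerFour → DepthCountedABC`.  Given `K, ε`, take `C(K, ε)` from the tower; for an
abc triple with at most `K` primes at depth `≥ 5` lift `a, b, c` optimally to level `4`
(`TowerFourGivesDepthCounted.exists_lift`) and take `S = {p : v_p(abc) ≥ 5}`; then
`v_p(∏ xᵢyᵢzᵢ) = ⌈v_p(abc)/4⌉` is `1` off `S`, so `(∏_{p∈S} p)·{∏ xᵢyᵢzᵢ}^S = rad(abc)` and the
tower inequality is `c < C · rad(abc)^(1+ε)`. [cite: Vojta2000ABC, §3.1] -/
theorem towerFourGivesDepthCounted_proof :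
    Summit.ABC.ABC.Theses.IneffectiveSubspace.TowerFourGivesDepthCounted := by
  unfold Summit.ABC.ABC.Theses.IneffectiveSubspace.TowerFourGivesDepthCounted
    Summit.ABC.ABC.Theses.IneffectiveSubspace.UniformSadicTowerFour
    Summit.ABC.ABC.Theses.IneffectiveSubspace.DepthCountedABC
  intro hT K ε hε
  obtain ⟨C, hC, hTow⟩ := hT K ε hε
  refine ⟨C, hC, fun a b c habc hK => ?_⟩
  obtain ⟨ha, hb, hsum, hcop⟩ := habc
  have hc : 0 < c := by omega
  obtain ⟨x, hx0, hxa, hxf⟩ := TowerFourGivesDepthCounted.exists_lift ha.ne'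
  obtain ⟨y, hy0, hyb, hyf⟩ := TowerFourGivesDepthCounted.exists_lift hb.ne'
  obtain ⟨z, hz0, hzc, hzf⟩ := TowerFourGivesDepthCounted.exists_lift hc.ne'
  -- the two other coprimalities of the triple
  have hac : Nat.Coprime a c := by
    rw [← hsum]; exact Nat.coprime_self_add_right.mpr hcop
  have hbc : Nat.Coprime b c := by
    rw [← hsum]; exact Nat.coprime_add_self_right.mpr hcop.symm
  -- valuations of the lifted point: `v_p(∏ xᵢyᵢzᵢ) = ⌈v_p(abc)/4⌉`
  have hPfac : ∀ p, (∏ i, x i * y i * z i).factorization p =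
      ((a * b * c).factorization p + 3) / 4 := by
    intro p
    have hx' : (∏ i, x i) ≠ 0 := (Finset.prod_pos fun i _ => hx0 i).ne'
    have hy' : (∏ i, y i) ≠ 0 := (Finset.prod_pos fun i _ => hy0 i).ne'
    have hz' : (∏ i, z i) ≠ 0 := (Finset.prod_pos fun i _ => hz0 i).ne'
    rw [Finset.prod_mul_distrib, Finset.prod_mul_distrib,
      Nat.factorization_mul (mul_ne_zero hx' hy') hz', Nat.factorization_mul hx' hy',
      Nat.factorization_mul (mul_ne_zero ha.ne' hb.ne') hc.ne', Nat.factorization_mul ha.ne' hb.ne']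
    simp only [Finsupp.add_apply, hxf, hyf, hzf]
    rcases TowerFourGivesDepthCounted.factorization_eq_zero_or hcop p with h1 | h1 <;>
    rcases TowerFourGivesDepthCounted.factorization_eq_zero_or hac p with h2 | h2 <;>
    rcases TowerFourGivesDepthCounted.factorization_eq_zero_or hbc p with h3 | h3 <;>
    omega
  -- hence the same prime factors as `abc`
  have hPpf : (∏ i, x i * y i * z i).primeFactors = (a * b * c).primeFactors := by
    ext p
    rw [← Nat.support_factorization, ← Nat.support_factorization, Finsupp.mem_support_iff,
      Finsupp.mem_support_iff, hPfac]
    constructor <;> intro h <;> omega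
  -- the deep primes `S = {p : v_p(abc) ≥ 5}`
  set S := (a * b * c).primeFactors.filter (fun p => 5 ≤ (a * b * c).factorization p) with hS
  have hSprime : ∀ p ∈ S, p.Prime := fun p hp =>
    Nat.prime_of_mem_primeFactors (Finset.mem_filter.mp hp).1
  have hSsub : S ⊆ (∏ i, x i * y i * z i).primeFactors := by
    rw [hPpf]; exact Finset.filter_subset _ _
  -- `(∏_{p∈S} p) · {∏ xᵢyᵢzᵢ}^S = rad(abc)` on the nose
  have hM : (∏ p ∈ S, p) * ∏ p ∈ (∏ i, x i * y i * z i).primeFactors \ S,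
      p ^ (∏ i, x i * y i * z i).factorization p =
      Literature.NumberTheory.DiophantineGeometry.rad a b c := by
    have h1 : ∏ p ∈ (∏ i, x i * y i * z i).primeFactors \ S,
        p ^ (∏ i, x i * y i * z i).factorization p =
        ∏ p ∈ (∏ i, x i * y i * z i).primeFactors \ S, p := by
      refine Finset.prod_congr rfl fun p hp => ?_
      rw [Finset.mem_sdiff, hPpf] at hp
      obtain ⟨hp1, hp2⟩ := hp
      have hne : (a * b * c).factorization p ≠ 0 :=
        Finsupp.mem_support_iff.mp (by rwa [Nat.support_factorization])
      have hlt : ¬ 5 ≤ (a * b * c).factorization p := fun h5 =>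
        hp2 (Finset.mem_filter.mpr ⟨hp1, h5⟩)
      have hv : (∏ i, x i * y i * z i).factorization p = 1 := by rw [hPfac]; omega
      rw [hv, pow_one]
    rw [h1, mul_comm, Finset.prod_sdiff hSsub, hPpf,
      Literature.NumberTheory.DiophantineGeometry.rad_def, Nat.radical_eq_prod_primeFactors]
  -- feed the lifted point to the tower
  have key := hTow S hK hSprime x y z (fun i => ⟨hx0 i, hy0 i, hz0 i⟩)
    (by rw [hxa, hyb, hzc]; exact hsum) (by rw [hxa, hyb]; exact hcop)
  rw [hzc, hM] at key
  exact key

end Summit.ABC.ABC.Theorems
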